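import Summits.QuantumFields.YangMills.Theorems.UnitScaleTiltProp7SectET3Geometry
import Literature.MathematicalPhysics.QuantumFieldTheory.Balaban1983to89.B9RWSums347DefiniteFaces
import HarnessLib

/-!
# Route `UnitScaleTilt` (α), node N06(d = 3) — **THE LEMMA-2.1 GEOMETRY ROWS OF THE KNIT ALONG AN ARBITRARY SUB-FAMILY `π : J → KIdx d ℓ hd hL b₀ b₁`
# OF def-Y's k-LEVEL INDEX** (the member-uniform thresholds of `Prop7SectET3Geometry` ∕ `Prop7SectET3G0LayerFromThm310.lemma21Pack_geo9K` ∕ `Prop7SectET3Floor.hnbr_geo9K_floor`,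
# restricted: the first brick of the «record re-cut over `{i // 1 ≤ i.m}`»)

Cell `ym-inputs` (D-0154 (2); desk `ym-inputs-plan-1` INPUT-LIST §4 row p05, HANDOFF §§ ym-inputs-p05 g2∕g3∕g4 item (2) «THE RECORD RE-CUT over `{i // 1 ≤ i.m}`», memo
`pub/ym-inputs/L0F-DEF-DESIGN-p05g2.md` §2 option (A)), seat ym-inputs-p05 g5.  Count-neutral helper (`--supports stmt-QuantumFields-20520 --as helper`); registry untouched;
THEOREMS ONLY (0 `def`, 0 `sorry`); NOTHING of [Balaban1984PropagatorsII] ∕ [Balaban1985BackgroundPropagators] is asserted.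

WHY.  The letter record of the N06(d = 3) leaves at the T³ members, `Prop7SectET3OpsT3.opsT3`, is GENUINE exactly on the indices with `1 ≤ i.m` and the zero record off them
(no `T3Family` has `m = 0`); the displayed analytic rows of the knit of record (`…N06LeavesRecordStepLayerEvalRowsSCut.normG_row_of_letterLayers_evaluationRowsSc` and its
parents) are `∀ i : KIdx 2 ℓ hd3 hL 1 1`-rows whose premises are satisfiable at the junk indices, so the knit can only be instantiated at `opsT3` once its chain is read over the
member subtype.  The chain's proofs use the index family through FOUR member-uniform geometry facts only — [4] Lemma 2.1 (2.61) with a generic constant above an `M`-threshold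
(`rowSum261_geo9K`), the level gap (2.60) (`levelGap_geo9K_one`), their two packagings (`lemma21AboveG_geo9K`, `lemma21Pack_geo9K`) and the neighbour count above a floor
(`hnbr_geo9K_floor`) — and every one of them restricts to ANY sub-family `x ↦ geo9K (π x)`.  This file states the restrictions once, π-generically; the originals are the `π := id`
instances, the re-cut uses `π := (·.1)` on `{i : KIdx 2 ℓ hd3 hL 1 1 // 1 ≤ i.m}`.

WHAT IS PROVED (ns `…Theorems.Prop7SectET3GeometryFam`; `π : J → KIdx d ℓ hd hL b₀ b₁` any map, any `d`):
* `levelGap_geo9K_one_fam` — `LevelGap (fun x ↦ geo9K (π x)) 1` ((2.60) with `RM` read as `1·M`);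
* `rowSum261_geo9K_fam` — `RowSum261 (fun x ↦ geo9K (π x))` ((2.61), generic constant, every rate);
* `lemma21AboveG_geo9K_fam` — for every `0 < α < 1`, `H : J → Prop`, `δ > 0`: `∃ M_L′ c′, Lemma21AboveG (fun x ↦ geo9K (π x)) (fun _ ↦ 1) H δ α M_L′ c′`;
* ★ `lemma21Pack_geo9K_fam` — the three Lemma-2.1 binders of Theorem 3.10's rows under ONE threshold: `Ineq261` at the door exponent `exp261 (fun x ↦ geo9K (π x)) δ₀ α`,
  `Facts347` at rate `((1 − 2α)δ₀, α_F)` and at rate `(δ₀, α)`, `L₀ = ℓ + 1` — `lemma21Pack_of_rowSum261` at the sub-family (the exponents are the SUB-FAMILY's own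
  `exp261`, as every consumer only needs some exponent);
* `hnbr_geo9K_floor_fam` — for every radius `r`: a floor `M⋆` and a count `mN` with `#(nbr (geo9K (π j)) r y) ≤ mN` on the floor subtype `{x : J // M⋆ ≤ (geo9K (π x)).M}`;
* `hCL_geo9K_floor_fam` — on that floor subtype (any `M⋆ > r`) two index bonds at distance `≤ r` have lengths within the factor `ℓ + 1`.
HONEST SCOPE: restrictions of landed member-uniform theorems along a map of index types; no estimate is proved here; nothing of print is asserted; N06(d = 3) NOT discharged; no
claim on EX, the crux, 19200 ∕ 20520 or the gap; YM₃ on T³ = rung R3 (RECORD), not T⁴, not the Clay problem.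

References: T. Bałaban, CMP **96** (1984) 223–250 [Balaban1984PropagatorsII] ((2.46) p.231, (2.59) p.233, Lemma 2.1 (2.60)–(2.61) p.234); CMP **99** (1985) 389–434
[Balaban1985BackgroundPropagators] (Thm 3.10 p.416, remark after (3.47) p.398).
-/

set_option autoImplicit false

noncomputable section

namespace Summit.QuantumFields.YangMills.Theorems.Prop7SectET3GeometryFam

open Literature.MathematicalPhysics.QuantumFieldTheory.Balaban1983to89
open Literature.MathematicalPhysics.QuantumFieldTheory.Balaban1983to89.B9Thm34Ext (toB6)
open Literature.MathematicalPhysics.QuantumFieldTheory.Balaban1983to89.B6KLevelCensusIndexV1 (KIdx)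
open Literature.MathematicalPhysics.QuantumFieldTheory.Balaban1983to89.B9GeoNormsKLevelV1 (geo9K)
open Literature.MathematicalPhysics.QuantumFieldTheory.Balaban1983to89.B9GeoLemma21KLevelV1
  (geo9K_one_le_L geo9K_eta_pos levelGap_geo9K_one rowSum261_geo9K)
open Literature.MathematicalPhysics.QuantumFieldTheory.Balaban1983to89.B9GeoNbrCountKLevelV1 (exists_card_nbr_geo9K_le)
open Literature.MathematicalPhysics.QuantumFieldTheory.Balaban1983to89.B9Thm312WholeLeft (Lemma21AboveG lemma21AboveG_of_above)
open Literature.MathematicalPhysics.QuantumFieldTheory.Balaban1983to89.B9RowSum261DefiniteFaces (exists_lemma21Above_of_rowSum261)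
open Literature.MathematicalPhysics.QuantumFieldTheory.Balaban1983to89.B9Ineq349Whole (RowSum261 LevelGap)
open Literature.MathematicalPhysics.QuantumFieldTheory.Balaban1983to89.B9RWSumsReadsNbr (nbr)
open Literature.MathematicalPhysics.QuantumFieldTheory.Balaban1983to89.B9RWSums343to347Whole (Facts347)
open Literature.MathematicalPhysics.QuantumFieldTheory.Balaban1983to89.B6RandomWalk (Ineq261)
open Literature.MathematicalPhysics.QuantumFieldTheory.Balaban1983to89.B9RWSums347DefiniteFaces (exp261 lemma21Pack_of_rowSum261)
open Literature.MathematicalPhysics.QuantumFieldTheory.Balaban1983to89.B9RWSumsCompleteGeo9YNbr (len_le_of_dist_lt_M_geo9K)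
open Summit.QuantumFields.YangMills.Theorems.Prop7SectET3Geometry (geo9K_L_le)

variable {d ℓ : ℕ} {hd : 1 ≤ d + 1} {hL : Odd (ℓ + 1) ∧ 1 < ℓ + 1} {b₀ b₁ : ℝ} {J : Type} (π : J → KIdx d ℓ hd hL b₀ b₁)

/-! ## §1 The two Lemma-2.1 schemas along a sub-family -/

/-- **(2.60) ALONG A SUB-FAMILY**: the level gap at `R₀ = 1` of the family `x ↦ geo9K (π x)` — def-Y's `levelGap_geo9K_one` read at `π x`.
[cite: Balaban1984PropagatorsII, Lemma 2.1 (2.60) p.234, (2.59) p.233] -/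
theorem levelGap_geo9K_one_fam : LevelGap (fun x : J => geo9K (π x)) 1 :=
  fun x y y' => levelGap_geo9K_one (d := d) (ℓ := ℓ) (hd := hd) (hL := hL) (b₀ := b₀) (b₁ := b₁) (π x) y y'

/-- **(2.61) WITH A GENERIC CONSTANT ALONG A SUB-FAMILY**: for every rate `κ > 0` the whole family's threshold `M_L(κ)` and constant `c(κ)` serve the sub-family
`x ↦ geo9K (π x)` — `rowSum261_geo9K` read at `π x`. [cite: Balaban1984PropagatorsII, Lemma 2.1 (2.61) p.234, (2.59) p.233] -/
theorem rowSum261_geo9K_fam [∀ i : KIdx d ℓ hd hL b₀ b₁, Fintype (geo9K i).Site] : RowSum261 (fun x : J => geo9K (π x)) := by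
  intro κ hκ
  obtain ⟨ML, c, h⟩ := rowSum261_geo9K (d := d) (ℓ := ℓ) (hd := hd) (hL := hL) (b₀ := b₀) (b₁ := b₁) κ hκ
  exact ⟨ML, c, fun x hM y => h (π x) hM y⟩

/-! ## §2 The two packagings of the chain of record, along a sub-family -/

/-- **`hL21` ALONG A SUB-FAMILY** (the sub-family twin of `Prop7SectET3Geometry.lemma21AboveG_geo9K`): for every weight exponent `0 < α < 1`, every side predicate
`H : J → Prop` and every rate `δ > 0` there are `M_L′, c′` with (2.60) at rate `αδ`, (2.61) at rate `(1 − α)δ` with constant `c′` and `4·log L ≤ α·δ·1·M` above `M_L′`, for the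
family `x ↦ geo9K (π x)` — n06-h's generic `exists_lemma21Above_of_rowSum261` at the sub-family's own (2.60)∕(2.61).
[cite: Balaban1984PropagatorsII, Lemma 2.1 (2.60)–(2.61) p.234, (2.59) p.233] -/
theorem lemma21AboveG_geo9K_fam [∀ i : KIdx d ℓ hd hL b₀ b₁, Fintype (geo9K i).Site] (H : J → Prop) {α : ℝ} (hα0 : 0 < α) (hα1 : α < 1) :
    ∀ δ : ℝ, 0 < δ → ∃ ML' c' : ℝ, Lemma21AboveG (fun x : J => geo9K (π x)) (fun _ => (1 : ℝ)) H δ α ML' c' := by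
  intro δ hδ
  obtain ⟨dd, ML, h⟩ := exists_lemma21Above_of_rowSum261 (geo := fun x : J => geo9K (π x))
    one_pos (levelGap_geo9K_one_fam π) (rowSum261_geo9K_fam π) (L := ((ℓ + 1 : ℕ) : ℝ)) (fun x => geo9K_one_le_L (π x)) (fun x => geo9K_L_le (π x)) H hα0 hα1 hδ
  exact ⟨ML, _, lemma21AboveG_of_above dd h⟩

/-- ★ **THE THREE LEMMA-2.1 BINDERS OF THEOREM 3.10's ROWS ALONG A SUB-FAMILY, UNDER ONE THRESHOLD** (the sub-family twin of
`Prop7SectET3G0LayerFromThm310.lemma21Pack_geo9K`): `h261` — `Ineq261` at rate `(δ₀, α)` with the sub-family's door exponent `exp261 (fun x ↦ geo9K (π x)) δ₀ α`; `hfacts` —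
p. 398's member facts at rate `((1 − 2α)δ₀, α_F)`; `hfacts₀` — the same at rate `(δ₀, α)`; `R` read as `1`, `L₀ = ℓ + 1` — Track A's generic `lemma21Pack_of_rowSum261` at the
sub-family's own level gap and row sum. [cite: Balaban1985BackgroundPropagators, Thm 3.10 p.416 + p.398 remark after (3.47); Balaban1984PropagatorsII, Lemma 2.1 (2.59)–(2.61) pp.233–234] -/
theorem lemma21Pack_geo9K_fam [∀ i : KIdx d ℓ hd hL b₀ b₁, Fintype (geo9K i).Site] (H : J → Prop) {α δ₀ αF : ℝ} (hα : 0 < α) (hα2 : α < 1 / 2)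
    (hδ₀ : 0 < δ₀) (hαF : 0 < αF) (hαF1 : αF < 1) :
    ∃ Mth : ℝ,
      (∀ x : J, Mth ≤ (geo9K (π x)).M → Ineq261 (exp261 (fun x : J => geo9K (π x)) δ₀ α) (toB6 (geo9K (π x)) 1 (H x)) δ₀ α) ∧
      (∀ x : J, Mth ≤ (geo9K (π x)).M →
        Facts347 (geo9K (π x)) 1 (H x) (exp261 (fun x : J => geo9K (π x)) ((1 - 2 * α) * δ₀) (1 - αF)) ((1 - 2 * α) * δ₀) αF ((ℓ + 1 : ℕ) : ℝ)) ∧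
      (∀ x : J, Mth ≤ (geo9K (π x)).M →
        Facts347 (geo9K (π x)) 1 (H x) (exp261 (fun x : J => geo9K (π x)) δ₀ (1 - α)) δ₀ α ((ℓ + 1 : ℕ) : ℝ)) :=
  lemma21Pack_of_rowSum261 (geo := fun x : J => geo9K (π x)) one_pos (levelGap_geo9K_one_fam π) (rowSum261_geo9K_fam π)
    (fun x => geo9K_one_le_L (π x)) (fun x => geo9K_L_le (π x)) (fun x => geo9K_eta_pos (π x)) H hα hα2 hδ₀ hαF hαF1

/-! ## §3 The two floor-dependent rows of the leaf of record, along a sub-family -/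

/-- **`hnbr` ABOVE A FLOOR, ALONG A SUB-FAMILY** (the sub-family twin of `Prop7SectET3Floor.hnbr_geo9K_floor`): for every radius `r` a floor `M⋆` and a count `mN` with
`#(nbr (geo9K (π j)) r y) ≤ mN` at every member of the floor subtype `{x : J // M⋆ ≤ (geo9K (π x)).M}` and every index bond `y` — n06-i's member-uniform
`exists_card_nbr_geo9K_le` read at `π j`. [cite: Balaban1984PropagatorsII, Lemma 2.1 (2.61) p.234, (2.59) p.233, (2.46) p.231] -/
theorem hnbr_geo9K_floor_fam [∀ i : KIdx d ℓ hd hL b₀ b₁, Fintype (geo9K i).Site] (r : ℝ) :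
    ∃ Mstar : ℝ, ∃ mN : ℕ, ∀ (j : {x : J // Mstar ≤ (geo9K (π x)).M}) (y : (geo9K (π j.1)).Site), (nbr (geo9K (π j.1)) r y).card ≤ mN := by
  obtain ⟨ML, mN, h⟩ := exists_card_nbr_geo9K_le (d := d) (ℓ := ℓ) (hd := hd) (hL := hL) (b₀ := b₀) (b₁ := b₁) r
  exact ⟨ML, mN, fun j y => h (π j.1) j.2 y⟩

/-- **`hCL` ABOVE A FLOOR, ALONG A SUB-FAMILY** (the sub-family twin of `Prop7SectET3Floor.hCL_geo9K_floor`): on every member of the floor subtype `{x : J // M⋆ ≤ (geo9K (π x)).M}`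
with `r < M⋆`, two index bonds at distance `≤ r` have scale lengths within the factor `C_L = ℓ + 1` (`len_le_of_dist_lt_M_geo9K`: neighbouring blocks differ by at most one level).
[cite: Balaban1984PropagatorsII, (2.2) p.224, Lemma 2.1 (2.60) p.234] -/
theorem hCL_geo9K_floor_fam {r Mstar : ℝ} (hr : r < Mstar) (j : {x : J // Mstar ≤ (geo9K (π x)).M}) (a a' : (geo9K (π j.1)).Site)
    (h : (geo9K (π j.1)).dist a a' ≤ r) : (geo9K (π j.1)).len a ≤ ((ℓ + 1 : ℕ) : ℝ) * (geo9K (π j.1)).len a' :=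
  len_le_of_dist_lt_M_geo9K (π j.1) (lt_of_le_of_lt h (hr.trans_le j.2))

end Summit.QuantumFields.YangMills.Theorems.Prop7SectET3GeometryFam

end
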